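/-
Copyright: see repository licence. Literature formalisation — Fitzner–van der Hofstad 2017, App. B
"Building blocks with weight": the entries of `𝐇^{(1)}` / `h^S`, `Σ_x ‖x‖₂² Ā^{a,b}(0,v,x,x+y)`, for an abstract
ι-free family, and the nine rows of one READING of the untabulated plain `Ā^{a,b}`.
-/
import Literature.Probability.FitznerVanDerHofstad2017.NobleWeightedBlocks
import HarnessLib

/-!
# [FvdH17] App. B "Building blocks with weight": the rows of `Σ_x H^{(1),a,b}(0,v,x,x+y)`

[FvdH17] = R. Fitzner, R. van der Hofstad, *Mean-field behavior for nearest-neighbor percolation in d > 10*,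
EJP 22 (2017) no. 43 (arXiv:1506.07977v2 = "v2"; the v1 "extended version" TeX sources are quoted by file and line
where v2 does not print the object); [NoBLE17-I] = R. Fitzner, R. van der Hofstad, *Generalized approach to the
non-backtracking lace expansion*, PTRF 169 (2017) 1041–1119 (arXiv:1506.07969).

App. B of [FvdH17] ("Building blocks with weight", v1 TeX `DetailsDefinitionBlocks.tex` l.35; v2 p. 78) defines the
weighted entry block `H^{(1),a,b}(u,v,x,y) = |u − x|² Ā^{a,b}(u,v,x,y)` over the ι-free double-open bubble `Ā^{a,b}`,
which the §5.1 table NAMES in its caption among the unweighted building blocks (v1 `Bounds/BoundsBuildingBlocks.tex`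
l.90) while its row defines only the ι-version (l.61–63 = v2 p. 47: "Double-open bubble `Ā^{ι,a,b}(0,v,x,y)`: Alike
`A^{ι,a,b}`. Both connections 0 ↔ v and x ↔ y contribute to the neighboring blocks").  In the tree (`NobleWeightedBlocks`) the
block is `blockH1 Abar0 a b u v x y = wt (u − x) * Abar0 a b u v x y` over an ABSTRACT family
`Abar0 : PlainBlockFamily d` (the plain table is not tabulated in print — reading note (1)), its matrix is
`(𝐇^{(1)})_{a,b} = sup_{v,y} Σ_x H^{(1),a,b}(0,v,x,x+y)` (`matH1`, the double-open-gap pattern of `normOO`) and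
`h^S_b = (𝐇^{(1)})_{0,b}` (`vechS`), which enters the `N ≥ 2` bounds through `h^S (A^ι)^T (B̄^ι)^{N−1} P^E`
(App. B (B.9)–(B.11); v1 `Bounds/BoundsNBig.tex` l.16).

## What this module proves (all statements kernel-checked; nothing is assumed)

* §A — GENERIC ENTRIES, for every `Abar0 : PlainBlockFamily d`.  `matH1_apply : matH1 Abar0 a b =
  ⨆ v, ⨆ y, ∑' x, wt x * Abar0 a b 0 v x (x + y)` (the weight `‖0 − x‖₂² = ‖x‖₂²`, `wt_neg`), `vechS_apply`,
  monotonicity in the family (`matH1_mono`, `vechS_mono`), the entry-from-row principles `matH1_le_of_forall`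
  (a uniform majorant of every open-gap fibre bounds the entry) and `matH1_le_of_rowShape` (a pointwise ROW-SHAPE
  hypothesis `Abar0 a b 0 v x (x+y) ≤ R v x y` bounds the entry by `⨆ v, ⨆ y, Σ_x ‖x‖₂² R v x y`), and the pinned-row
  evaluation `tsum_wt_mul_kd_mul` (`Σ_x ‖x‖₂² δ_{x,z} G(x) = ‖z‖₂² G(z)`; the private `δ_{x,x+y} = δ_{y,0}` is bookkeeping).  These survive whatever member list an
  event-level consumer finally proves `Σ_x ‖x‖₂² Ξ^{(1)} ≤ …` with.
* §0 — A READING (additive declarations, new names; NOT a transcription).  `blockAbarPl₀ L a b v x y` /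
  `blockAbarPl L a b := ofBase (blockAbarPl₀ L a b)`: the untabulated plain `Ā^{a,b}` read as the App. B recipe (ii)
  for `Ā^{ι,a,b}` (v2 p. 78; v1 `DetailsDefinitionBlocks.tex` l.17–25; tree `NobleBlocks.blockAbar₀`) applied to
  `NobleBlocks.blockA₀` with the pivotal bond removed — reading note (1).
* §C — THE NINE ROWS OF THE READING, for a general letter table `L` (`NobleBlocks.Letters`): for every
  `(a,b) ∈ {0,1,2}²` the open-gap fibre `Σ_x H^{(1),a,b}(0,v,x,x+y)` of the family `blockAbarPl L` in closed form —
  the `b = 0` rows are `δ_{y,0}`-PINNED weighted closed diagrams through `v` (stated exactly: `(0,0)`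
  `δ_{y,0} δ_{v,0} Σ_x ‖x‖₂² P(0 ⇔ x)`, `(1,0)` `δ_{y,0} 2dD(v) Σ_x ‖x‖₂² B_{1,1}(x,v)`, `(2,0)`
  `δ_{y,0} Σ_x ‖x‖₂² B_{1,0}(x,v)`), the `b = 1` rows are exact over the repulsive triangle `T` WITH THE FACTOR `p⁻¹`
  (`(0,1)`, `(1,1)`, `(2,1)`), and the `b ≥ 2` rows are weighted NON-repulsive (starred) bubbles in the letters `τ_{≥1}`, `τ` (`(2,2)`
  `Σ_x ‖x‖₂² τ_{≥1}(x) τ(v − x − y)`, `(1,2)` `p⁻¹ τ_{1̲}(−v) · Σ_x ‖x‖₂² τ(v − x − y) τ_{≥1}(x)`, `(0,2)`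
  `δ_{v,0} Σ_x ‖x‖₂² τ_{≥1}(−x − y) τ_{≥1}(x)`).  Every §C docstring says "for the READING `blockAbarPl`".

## Reading notes

(1) THE READING AND ITS STATUS.  [FvdH17] prints the ι-indexed display `Ā^{ι,a,b}` (v2 p. 78) and uses the ι-free
`Ā^{a,b}` in exactly one place, (B.6) `H^{(1),a,b} = ‖u − x‖₂² Ā^{a,b}` (v1 `DetailsDefinitionBlocks.tex` l.35 = v2 TeX
l.10611; `H^{(2)}`, `H^{(3)}` are over `Ā^{ι,a,b,*}`), without tabulating it — the string `\bar A^{a,b}` occurs once in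
each printed generation, `\bar A` not at all in [NoBLE17-I] (packet question Q-N76-1, DIVERGENCE D95 (provisional id); literature seat GAPS entry
l.1070–1071; the notebook prices `Bound[H2,a,b] = Bound[H1,a,b]`, packet divergence D83).  `blockAbarPl₀` is the
recipe of App. B (ii) applied to `blockA₀` with the pivotal first bond `(0, e_ι)` (base point `u = 0`; the leg `1̲`
from `0` to `e` of the typed `blockAiota₀` ∕ `blockAbar₀`) removed: rows `b = 0`: `A^{a,0}` itself; rows `b = 1`: `p⁻¹ A^{a,1}` ("Ā^{ι,a,1} = p⁻¹ A^{ι,a,1}");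
rows `b ≥ 2` (the three departures from a verbatim source, each = the printed `Ā^{ι}` member minus the bond):
`(0,≥2)` `δ_{0,v} B*_{1,1}(−y, x − y)` for the printed `δ_{0,v} T*`; `(1,≥2)` `p⁻¹ T*_{0,1̲,1}(v − y, −y, x − y)` for
the printed `p⁻¹ S*`; `(2,≥2)` `τ_{≥1}(x) τ(v − y)` for the printed `p τ(x − e_ι) τ(v − y)`.  This is a READING,
classed so in the packet's DIVERGENCE ledger; NOTHING in the tree or in any certificate consumes
`matH1 (blockAbarPl …)` as "the paper's `H^{(1)}` table" — an event-level theorem with that family would have to land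
first.  If a different member is forced later, only §0/§C are superseded (additively, under new names); §A stands.
(2) `p`-PLACEMENT (for dictionary readers).  The `b = 1` rows carry the factor `p⁻¹` at face value (the repulsive
`T` with the bond probability divided out); an outward numerical pricing divides by a LOWER bound for `p`, and it is
the class-`1̲` AVERAGE over the unit offsets (packet D67; `BlockSummationAvg`) — not this module — that turns the
factor `2dD(v)` of rows `(1,0)`, `(1,1)` into a `1/(2d)`-type normalisation.
(3) `d` is a free parameter; no numeral beyond `2d` (inside `twoDD`); no identification of any row with a notebook
cell or a certificate constant is made here.
(4) NOT in this module: the percolation instance `L = Letters.perc d p` of the §C rows, `H^{(2)}` (whose bound the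
paper's notebook takes equal to `H^{(1)}`'s, packet D83), `H^{(3)}` (`NobleWeightedRowsH3`), and any relation between
the plain `Ā^{a,b}` and the ι-indexed `Ā^{ι,a,b}`.
-/

noncomputable section

namespace Literature.Probability.FitznerVanDerHofstad2017.NobleBlocks

open Literature.Probability.LatticeModels Literature.Probability.Percolation
open Literature.Probability.FitznerVanDerHofstad2017.BlockSummation
open scoped BigOperators ENNReal

variable {d : ℕ}

/-! ## §A. Generic entries of `𝐇^{(1)}` and `h^S` for an abstract ι-free family -/

/-- `(𝐇^{(1)})_{a,b} = sup_{v,y} Σ_x ‖x‖₂² Ā^{a,b}(0,v,x,x+y)` (the weight `|u − x|²` at `u = 0`).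
[cite: FitznerVanDerHofstad2017, App. B "Building blocks with weight" (arXiv:1506.07977v2 p. 78; v1 TeX DetailsDefinitionBlocks.tex l.35) with (B.9)–(B.11)] -/
theorem matH1_apply (Abar0 : PlainBlockFamily d) (a b : Fin 3) :
    matH1 Abar0 a b = ⨆ v, ⨆ y, ∑' x, wt x * Abar0 a b 0 v x (x + y) := by
  simp only [matH1, Matrix.of_apply, normOO, blockH1, zero_sub, wt_neg]

/-- `(h^S)_b = sup_{v,y} Σ_x ‖x‖₂² Ā^{0,b}(0,v,x,x+y)`.
[cite: FitznerVanDerHofstad2017, App. B (B.9)–(B.11) (arXiv:1506.07977v2 p. 79): `h^S_b = (𝐇^{(1)})_{0,b}`] -/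
theorem vechS_apply (Abar0 : PlainBlockFamily d) (b : Fin 3) :
    vechS Abar0 b = ⨆ v, ⨆ y, ∑' x, wt x * Abar0 0 b 0 v x (x + y) := by
  rw [vechS, matH1_apply]

/-- `𝐇^{(1)}` is monotone in the family, entrywise (only the `u = 0` slice of the family matters).
[cite: FitznerVanDerHofstad2017, App. B "Building blocks with weight" (arXiv:1506.07977v2 p. 78)] -/
theorem matH1_mono {A₁ A₂ : PlainBlockFamily d} {a b : Fin 3} (h : ∀ v x y, A₁ a b 0 v x y ≤ A₂ a b 0 v x y) :
    matH1 A₁ a b ≤ matH1 A₂ a b := by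
  rw [matH1_apply, matH1_apply]
  exact iSup_mono fun v => iSup_mono fun y => ENNReal.tsum_le_tsum fun x => mul_le_mul' le_rfl (h v x (x + y))

/-- `h^S` is monotone in the family.
[cite: FitznerVanDerHofstad2017, App. B (B.9)–(B.11) (arXiv:1506.07977v2 p. 79)] -/
theorem vechS_mono {A₁ A₂ : PlainBlockFamily d} {b : Fin 3} (h : ∀ v x y, A₁ 0 b 0 v x y ≤ A₂ 0 b 0 v x y) :
    vechS A₁ b ≤ vechS A₂ b := matH1_mono h

/-- Entry bound from a uniform row bound: if `Σ_x ‖x‖₂² Ā^{a,b}(0,v,x,x+y) ≤ C` for all `v, y` then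
`(𝐇^{(1)})_{a,b} ≤ C`.
[cite: FitznerVanDerHofstad2017, App. B "Building blocks with weight" (arXiv:1506.07977v2 p. 78): the entries are suprema over the gaps] -/
theorem matH1_le_of_forall {Abar0 : PlainBlockFamily d} {a b : Fin 3} {C : ℝ≥0∞}
    (h : ∀ v y, ∑' x, wt x * Abar0 a b 0 v x (x + y) ≤ C) : matH1 Abar0 a b ≤ C := by
  rw [matH1_apply]; exact iSup_le fun v => iSup_le fun y => h v y

/-- Entry bound from a pointwise ROW-SHAPE hypothesis: if `Ā^{a,b}(0,v,x,x+y) ≤ R(v,x,y)` member by member then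
`(𝐇^{(1)})_{a,b} ≤ sup_{v,y} Σ_x ‖x‖₂² R(v,x,y)`.
[cite: FitznerVanDerHofstad2017, App. B "Building blocks with weight" (arXiv:1506.07977v2 p. 78)] -/
theorem matH1_le_of_rowShape {Abar0 : PlainBlockFamily d} {a b : Fin 3} {R : Site d → Site d → Site d → ℝ≥0∞}
    (h : ∀ v x y, Abar0 a b 0 v x (x + y) ≤ R v x y) :
    matH1 Abar0 a b ≤ ⨆ v, ⨆ y, ∑' x, wt x * R v x y := by
  rw [matH1_apply]
  exact iSup_mono fun v => iSup_mono fun y => ENNReal.tsum_le_tsum fun x => mul_le_mul' le_rfl (h v x y)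

/-- A pinned row evaluates to its single member: `Σ_x ‖x‖₂² δ_{x,z} G(x) = ‖z‖₂² G(z)`.
[cite: FitznerVanDerHofstad2017, App. B table "A^{ι,a,b}" (arXiv:1506.07977v2 p. 78): the `δ_{x,y}`-pinned rows `b = 0`] -/
theorem tsum_wt_mul_kd_mul (z : Site d) (G : Site d → ℝ≥0∞) :
    ∑' x, wt x * (kd x z * G x) = wt z * G z := by
  rw [← tsum_ite_eq z (fun _ => wt z * G z)]
  congr 1; funext x
  by_cases hx : x = z
  · subst hx; simp [kd]
  · simp [kd, hx]

/-- `δ_{x,x+y} = δ_{y,0}` (bookkeeping for the pinned rows in the open-gap pattern `y ↦ x + y`; private twin of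
`NobleWeightedRowsH3.kd_self_add`, kept local so that this module imports built modules only). [folklore] -/
private theorem kd_self_add_right (x y : Site d) : kd x (x + y) = kd y 0 := by
  unfold kd
  by_cases hy : y = 0
  · simp [hy]
  · rw [if_neg (fun h => hy (by simpa using h.symm)), if_neg hy]

/-! ## §0. A READING of the untabulated plain `Ā^{a,b}` (additive declarations) -/

/-- READING of the untabulated plain `Ā^{a,b}`: recipe App. B (ii) [v2 p. 78, `DetailsDefinitionBlocks.tex`
l.17–25] applied to `blockA₀` with the pivotal bond removed, per §5.1 Table row (i) [v2 p. 47,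
`BoundsBuildingBlocks.tex` l.61–63, caption l.90] and the consumer (B.6) (iii) [l.35]; = lit-g15 GAPS l.1071;
NOT a transcription — DIVERGENCE D95 (provisional id, DIVERGENCE.md l.813–816; numbered of record by the referee) — Q-N76-1 open.  Three-point form `(v,x,y)` at `u = 0`; rows: `b = 0`: `A^{a,0}(v,x,y)`;
`b = 1`: `p⁻¹ A^{a,1}(v,x,y)`; `(0,≥2)`: `δ_{0,v} B*_{1,1}(−y, x−y)`; `(1,≥2)`: `p⁻¹ T*_{0,1̲,1}(v−y, −y, x−y)`;
`(2,≥2)`: `τ_{≥1}(x) τ(v−y)`.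
[cite: FitznerVanDerHofstad2017, App. B table "Ā^{ι,a,b}" recipe (ii) (arXiv:1506.07977v2 p. 78) with §5.1 Table row (i) (p. 47) — a READING, see the module docstring, reading note (1)] -/
def blockAbarPl₀ (L : Letters d) (a b : Fin 3) (v x y : Site d) : ℝ≥0∞ :=
  match a.val, b.val with
  | _, 0 => blockA₀ L a b v x y
  | _, 1 => L.p⁻¹ * blockA₀ L a b v x y
  | 0, _ => kd v 0 * L.Bst (.ge 1) (.ge 1) (-y) (x - y)
  | 1, _ => L.p⁻¹ * L.Tst (.ge 0) (.eq 1) (.ge 1) (v - y) (-y) (x - y)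
  | _, _ => L.tau (.ge 1) x * L.tau (.ge 0) (v - y)

/-- The four-point READING `Ā^{a,b}(u,v,x,y) := Ā^{a,b}_0(v−u, x−u, y−u)` (translation to `u = 0`,
`NobleBlocks.ofBase`), a `PlainBlockFamily`.
[cite: FitznerVanDerHofstad2017, App. B (arXiv:1506.07977v2 p. 78) with §5.1 Table row (i) (p. 47) — a READING, see `blockAbarPl₀`] -/
def blockAbarPl (L : Letters d) (a b : Fin 3) : Site d → Site d → Site d → Site d → ℝ≥0∞ :=
  ofBase (blockAbarPl₀ L a b)

/-! ## §C. The nine rows of the READING for a general letter table -/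

section Rows

variable (L : Letters d)

/-- For the READING `blockAbarPl`: Row `(2,2)`: `Σ_x ‖x‖² Ā^{2,2}(0,v,x,x+y) = Σ_x ‖x‖² τ_{≥1}(x) τ(v−x−y)`.
[cite: FitznerVanDerHofstad2017, App. B "Building blocks with weight" and table "Ā^{ι,a,b}" recipe (ii) (arXiv:1506.07977v2 p. 78); §5.1 Table row (i) (p. 47) — a row of a READING, module docstring note (1)] -/
theorem tsum_blockH1Pl_two_two (v y : Site d) :
    ∑' x, blockH1 (blockAbarPl L) 2 2 0 v x (x + y) = ∑' x, wt x * (L.tau (.ge 1) x * L.tau (.ge 0) (v - (x + y))) := by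
  refine tsum_congr fun x => ?_
  rw [blockH1, blockAbarPl, ofBase_zero, zero_sub, wt_neg]
  rfl

/-- For the READING `blockAbarPl`: Row `(0,2)`: `Σ_x ‖x‖² Ā^{0,2}(0,v,x,x+y) = δ_{v,0} Σ_x ‖x‖² τ_{≥1}(−(x+y)) τ_{≥1}(x)`.
[cite: FitznerVanDerHofstad2017, App. B "Building blocks with weight" and table "Ā^{ι,a,b}" recipe (ii) (arXiv:1506.07977v2 p. 78); §5.1 Table row (i) (p. 47) — a row of a READING, module docstring note (1)] -/
theorem tsum_blockH1Pl_zero_two (v y : Site d) :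
    ∑' x, blockH1 (blockAbarPl L) 0 2 0 v x (x + y) =
      kd v 0 * ∑' x, wt x * (L.tau (.ge 1) (-(x + y)) * L.tau (.ge 1) x) := by
  rw [← ENNReal.tsum_mul_left]
  refine tsum_congr fun x => ?_
  rw [blockH1, blockAbarPl, ofBase_zero, zero_sub, wt_neg]
  have e : blockAbarPl₀ L 0 2 v x (x + y) = kd v 0 * (L.tau (.ge 1) (-(x + y)) * L.tau (.ge 1) (x - (x + y) - -(x + y))) := rfl
  rw [e, show x - (x + y) - -(x + y) = x by abel]
  ring

/-- For the READING `blockAbarPl`: Row `(1,2)`: `Σ_x ‖x‖² Ā^{1,2}(0,v,x,x+y) = p⁻¹ τ_{1̲}(−v) Σ_x ‖x‖² τ(v−(x+y)) τ_{≥1}(x)`.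
`p`-FLAG: the factor `p⁻¹` is carried AT FACE VALUE (the printed `1/p`); an outward numerical pricing divides by a LOWER bound for `p` —
never price `p⁻¹` as `p`; see reading note (2).
[cite: FitznerVanDerHofstad2017, App. B "Building blocks with weight" and table "Ā^{ι,a,b}" recipe (ii) (arXiv:1506.07977v2 p. 78); §5.1 Table row (i) (p. 47) — a row of a READING, module docstring note (1)] -/
theorem tsum_blockH1Pl_one_two (v y : Site d) :
    ∑' x, blockH1 (blockAbarPl L) 1 2 0 v x (x + y) =
      L.p⁻¹ * L.tau (.eq 1) (-v) * ∑' x, wt x * (L.tau (.ge 0) (v - (x + y)) * L.tau (.ge 1) x) := by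
  rw [← ENNReal.tsum_mul_left]
  refine tsum_congr fun x => ?_
  rw [blockH1, blockAbarPl, ofBase_zero, zero_sub, wt_neg]
  have e : blockAbarPl₀ L 1 2 v x (x + y) = L.p⁻¹ * (L.tau (.ge 0) (v - (x + y)) *
      L.tau (.eq 1) (-(x + y) - (v - (x + y))) * L.tau (.ge 1) (x - (x + y) - -(x + y))) := rfl
  rw [e, show x - (x + y) - -(x + y) = x by abel, show -(x + y) - (v - (x + y)) = -v by abel]
  ring

/-- For the READING `blockAbarPl`: Row `(2,0)` (pinned, `δ_{x,x+y} = δ_{y,0}`): `Σ_x ‖x‖² Ā^{2,0}(0,v,x,x+y) = δ_{y,0} Σ_x ‖x‖² B_{1,0}(x,v)`.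
[cite: FitznerVanDerHofstad2017, App. B "Building blocks with weight" and table "Ā^{ι,a,b}" recipe (ii) (arXiv:1506.07977v2 p. 78); §5.1 Table row (i) (p. 47) — a row of a READING, module docstring note (1)] -/
theorem tsum_blockH1Pl_two_zero (v y : Site d) :
    ∑' x, blockH1 (blockAbarPl L) 2 0 0 v x (x + y) = kd y 0 * ∑' x, wt x * L.B (.ge 1) (.ge 0) x v := by
  rw [← ENNReal.tsum_mul_left]
  refine tsum_congr fun x => ?_
  rw [blockH1, blockAbarPl, ofBase_zero, zero_sub, wt_neg]
  have e : blockAbarPl₀ L 2 0 v x (x + y) = kd x (x + y) * L.B (.ge 1) (.ge 0) x v := rfl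
  rw [e, kd_self_add_right]
  ring


/-- For the READING `blockAbarPl`: Row `(0,0)`: `Σ_x ‖x‖² Ā^{0,0}(0,v,x,x+y) = δ_{y,0} δ_{v,0} Σ_x ‖x‖² P(0 ⇔ x)`.
The printed member excludes `x = 0` (`(1−δ_{0,x})`, the letter `pdbc`); under the weight the distinction is immaterial (`wt 0 = 0`, and `pdbc x = dbc x` for `x ≠ 0`), whence the letter `dbc` on the right (carver read, STATUS l.4084).
[cite: FitznerVanDerHofstad2017, App. B "Building blocks with weight" and table "Ā^{ι,a,b}" recipe (ii) (arXiv:1506.07977v2 p. 78); §5.1 Table row (i) (p. 47) — a row of a READING, module docstring note (1)] -/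
theorem tsum_blockH1Pl_zero_zero (v y : Site d) :
    ∑' x, blockH1 (blockAbarPl L) 0 0 0 v x (x + y) = kd y 0 * kd v 0 * ∑' x, wt x * L.dbc x := by
  rw [← ENNReal.tsum_mul_left]
  refine tsum_congr fun x => ?_
  rw [blockH1, blockAbarPl, ofBase_zero, zero_sub, wt_neg]
  have e : blockAbarPl₀ L 0 0 v x (x + y) = kd x (x + y) * kd v 0 * (kdc x 0 * L.pdbc x) := rfl
  rw [e, kd_self_add_right]
  by_cases hx : x = 0
  · subst hx; simp
  · rw [kdc_of_ne hx, Letters.pdbc, if_neg hx]; ring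

/-- For the READING `blockAbarPl`: Row `(1,0)`: `Σ_x ‖x‖² Ā^{1,0}(0,v,x,x+y) = δ_{y,0} 2dD(v) Σ_x ‖x‖² B_{1,1}(x,v)`.
`2dD(v)`-FLAG: the class-`1̲` AVERAGE over the `2d` unit offsets (`BlockSummationAvg`), not this row, turns `2dD(v)` into a
`1/(2d)`-type normalisation; see reading note (2).
[cite: FitznerVanDerHofstad2017, App. B "Building blocks with weight" and table "Ā^{ι,a,b}" recipe (ii) (arXiv:1506.07977v2 p. 78); §5.1 Table row (i) (p. 47) — a row of a READING, module docstring note (1)] -/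
theorem tsum_blockH1Pl_one_zero (v y : Site d) :
    ∑' x, blockH1 (blockAbarPl L) 1 0 0 v x (x + y) = kd y 0 * twoDD v * ∑' x, wt x * L.B (.ge 1) (.ge 1) x v := by
  rw [← ENNReal.tsum_mul_left]
  refine tsum_congr fun x => ?_
  rw [blockH1, blockAbarPl, ofBase_zero, zero_sub, wt_neg]
  have e : blockAbarPl₀ L 1 0 v x (x + y) = kd x (x + y) * twoDD v * L.B (.ge 1) (.ge 1) x v := rfl
  rw [e, kd_self_add_right]
  ring

/-- For the READING `blockAbarPl`: Row `(0,1)`: `Σ_x ‖x‖² Ā^{0,1}(0,v,x,x+y) = p⁻¹ δ_{v,0} Σ_x ‖x‖² (1−δ_{x+y,v}) T_{1,1̲,1}(x,x+y,0)`.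
`p`-FLAG: the factor `p⁻¹` is carried AT FACE VALUE (the printed `1/p`); an outward numerical pricing divides by a LOWER bound for `p` —
never price `p⁻¹` as `p`; see reading note (2).
[cite: FitznerVanDerHofstad2017, App. B "Building blocks with weight" and table "Ā^{ι,a,b}" recipe (ii) (arXiv:1506.07977v2 p. 78); §5.1 Table row (i) (p. 47) — a row of a READING, module docstring note (1)] -/
theorem tsum_blockH1Pl_zero_one (v y : Site d) :
    ∑' x, blockH1 (blockAbarPl L) 0 1 0 v x (x + y) =
      L.p⁻¹ * kd v 0 * ∑' x, wt x * (kdc (x + y) v * L.T (.ge 1) (.eq 1) (.ge 1) x (x + y) 0) := by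
  rw [← ENNReal.tsum_mul_left]
  refine tsum_congr fun x => ?_
  rw [blockH1, blockAbarPl, ofBase_zero, zero_sub, wt_neg]
  have e : blockAbarPl₀ L 0 1 v x (x + y) = L.p⁻¹ * (kd v 0 * kdc (x + y) v * L.T (.ge 1) (.eq 1) (.ge 1) x (x + y) 0) := rfl
  rw [e]
  ring

/-- For the READING `blockAbarPl`: Row `(1,1)`: `Σ_x ‖x‖² Ā^{1,1}(0,v,x,x+y) = p⁻¹ 2dD(v) Σ_x ‖x‖² T_{1,1̲,0}(x,x+y,v)`.
`p`-FLAG: the factor `p⁻¹` is carried AT FACE VALUE (the printed `1/p`); an outward numerical pricing divides by a LOWER bound for `p` —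
never price `p⁻¹` as `p`; see reading note (2).
`2dD(v)`-FLAG: the class-`1̲` AVERAGE over the `2d` unit offsets (`BlockSummationAvg`), not this row, turns `2dD(v)` into a
`1/(2d)`-type normalisation; see reading note (2).
[cite: FitznerVanDerHofstad2017, App. B "Building blocks with weight" and table "Ā^{ι,a,b}" recipe (ii) (arXiv:1506.07977v2 p. 78); §5.1 Table row (i) (p. 47) — a row of a READING, module docstring note (1)] -/
theorem tsum_blockH1Pl_one_one (v y : Site d) :
    ∑' x, blockH1 (blockAbarPl L) 1 1 0 v x (x + y) =
      L.p⁻¹ * twoDD v * ∑' x, wt x * L.T (.ge 1) (.eq 1) (.ge 0) x (x + y) v := by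
  rw [← ENNReal.tsum_mul_left]
  refine tsum_congr fun x => ?_
  rw [blockH1, blockAbarPl, ofBase_zero, zero_sub, wt_neg]
  have e : blockAbarPl₀ L 1 1 v x (x + y) = L.p⁻¹ * (twoDD v * L.T (.ge 1) (.eq 1) (.ge 0) x (x + y) v) := rfl
  rw [e]
  ring

/-- For the READING `blockAbarPl`: Row `(2,1)`: `Σ_x ‖x‖² Ā^{2,1}(0,v,x,x+y) = p⁻¹ Σ_x ‖x‖² T_{1,1̲,0}(x,x+y,v)`.
`p`-FLAG: the factor `p⁻¹` is carried AT FACE VALUE (the printed `1/p`); an outward numerical pricing divides by a LOWER bound for `p` —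
never price `p⁻¹` as `p`; see reading note (2).
[cite: FitznerVanDerHofstad2017, App. B "Building blocks with weight" and table "Ā^{ι,a,b}" recipe (ii) (arXiv:1506.07977v2 p. 78); §5.1 Table row (i) (p. 47) — a row of a READING, module docstring note (1)] -/
theorem tsum_blockH1Pl_two_one (v y : Site d) :
    ∑' x, blockH1 (blockAbarPl L) 2 1 0 v x (x + y) = L.p⁻¹ * ∑' x, wt x * L.T (.ge 1) (.eq 1) (.ge 0) x (x + y) v := by
  rw [← ENNReal.tsum_mul_left]
  refine tsum_congr fun x => ?_
  rw [blockH1, blockAbarPl, ofBase_zero, zero_sub, wt_neg]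
  have e : blockAbarPl₀ L 2 1 v x (x + y) = L.p⁻¹ * L.T (.ge 1) (.eq 1) (.ge 0) x (x + y) v := rfl
  rw [e]
  ring

end Rows

end Literature.Probability.FitznerVanDerHofstad2017.NobleBlocks

end
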